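import Summits.ABC.IUTFork.Joshi.UntiltGauss
import Summits.ABC.IUTFork.Joshi.UntiltTopIsoDilation
import Summits.ABC.IUTFork.Joshi.ATS1UntiltsOfFundamentalGroups
import Summits.ABC.IUTFork.Joshi.UntiltRescaled
import Mathlib.NumberTheory.Real.Irrational
import HarnessLib

/-!
# The kernel separates `ℂ_p` from the Gauss untilt: `Untilt.TopIso` fails, [J-I] Thm. 7.4.3 (1) AS TYPED is hypothesis-free, and a two-point signature carries `ExistsNonIsomorphic ∧ ActionChangesTopology ∧ ¬ ActionDilates`

Proof-only sequel (abc-iut cell, branch E, rung LADDER-ABC:A2.E; seat abc-iut-E-t55 g3) of `Joshi/UntiltGauss.lean`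
(the Gauss untilt `Untilt.gauss p r hr`, `‖p‖ = p⁻¹`, an element of norm `r`, isometric `Q̄_p ↪ 𝔾`), over E-t1's
`Untilt` / `Untilt.TopIso` / `ATSObj` / `ATSObj.self` / `UntiltPoints` (+ `ExistsNonIsomorphic`, `ActionChangesTopology`,
`ActionDilates`, `IsDilatation`, `exponent`) (p428170, p429850, p431060), E-t17's `ATS1.Thm743NonIso` /
`thm743NonIso_of_not_topIso` (p430648), my `Untilt.TopEquiv.norm_eq_of_norm_p_eq` (p438930) and E-t17's `e1`/`e2`
(p43xxxx `UntiltRescaled`) — all BY NAME; no definition of theirs touched, no `Prop` claim, no fact, no sorry.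

Source and caveat: K. Joshi, arXiv 2106.11452 **v4** (UNREFEREED; typed AS A CANDIDATE, D-0012), §3.7 p.10 l.14–17
«there exist untilts of `ℂ_p^♭` which are not topologically isomorphic … [Kedlaya and Temkin, 2018, Theorem 1.3]»;
Def. 4.1.1 p.18 l.11–22; Prop. 4.1.7 p.19 l.22–33 («(2) There exist arithmetic holomorphic structures … which are not
isomorphic. Furthermore, if `F = ℂ_p^♭`, then `K₁, K₂` need not even be topologically isomorphic»); Thm. 7.4.3 (1)
p.42 l.21–27 «Non-isomorphic arithmetic holomorphic structures on `X/E` (Definition 4.1.1) exist (by Lemma 4.1.7)».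
The Gauss untilt is NOT an untilt of `ℂ_p^♭` (Prop. 4.1.7 (1): same tilt ⇒ same value group; here the value group
contains `p^√2`), so NOTHING below is [KedlayaTemkin2018] or Joshi's same-tilt mechanism: the results are about the
TYPED predicates, whose carriers (E-t1's `Untilt p`, `UntiltPoints`) record no tilt — and they calibrate exactly that.

WHAT IS PROVED.
* `exists_norm_pow_eq_padicComplex` — THE VALUE SET OF `ℂ_p` in kernel: every `y ≠ 0` has `‖y‖ⁿ = p^m` for some
  `n ≥ 1`, `m ∈ ℤ` (Mathlib `spectralNorm_eq_norm_coeff_zero_rpow` on `Q̄_p` + density + the ultrametric equality);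
* `not_topIso_padicComplex_of_norm` — an untilt with `‖p‖ = p⁻¹` holding an element of norm `r`, `rⁿ ≠ p^m`, is NOT
  topologically isomorphic to `ℂ_p` (a topological isomorphism would be an ISOMETRY by p438930); with `r = p^√2`
  (`irrational_sqrt_two`): **`Untilt.not_topIso_padicComplex_gaussIrr`** — `¬ ℂ_p.TopIso 𝔾`;
* **`ATS1.thm743NonIso_holds`** — [J-I] Thm. 7.4.3 (1) AS TYPED (`∃ A B : ATSObj X, ¬ A.IsIso B`) for EVERY
  `X : TemperedCurve p`, HYPOTHESIS-FREE (objects `(X, E ↪ ℂ_p, id)` and `(X, E ↪ 𝔾, id)`); `ATSObj.variation_not_isTrivial`;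
* the TWO-POINT SIGNATURE `GaussUntilt.twoPoint p : UntiltPoints p (ZMod 2)` (`𝒢 = 𝔽₂²`, points `e₁ ↦ ℂ_p`, `e₂, e₁+e₂ ↦ 𝔾`,
  the swap as automorphism): **`twoPoint_existsNonIsomorphic`**, **`twoPoint_actionChangesTopology`** (first kernel
  inhabitants of E-t1's two named `Prop`s), and — the configuration the E1 dictionary lanes did not have —
  `twoPoint_exponent` (= 1 everywhere), `twoPoint_isDilatation_one`, **`twoPoint_not_actionDilates`**: a change of
  holomorphic structure that is ISOMETRIC ON `Q̄_p` (every valuation/exponent read-out on `Q̄_p` is constant: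
  `twoPoint_normQp`) and nevertheless NOT a topological isomorphism. Typed ≠ proved ≠ endorsed; no side taken on
  [IUTchIII] Cor. 3.12 or on any author. bears_on: LADDER-ABC:A2.E.
-/

noncomputable section

open Polynomial NNReal
open Literature.AnabelianGeometry.SemiGraphs (TemperedCurve)

namespace Summit.ABC.IUTFork.Joshi

variable (p : ℕ) [Fact p.Prime]

namespace GaussUntilt

/-! ## 1. The value set of `ℂ_p` -/

/-- Every nonzero `x ∈ Q̄_p` has `‖x‖ⁿ = p^m` with `n = deg minpoly ≥ 1`, `m = −v_p(a₀)` (the spectral norm is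
`‖a₀‖^{1/n}`, Mathlib `spectralNorm_eq_norm_coeff_zero_rpow`). [folklore] -/
theorem exists_norm_pow_eq_padicAlgCl (x : PadicAlgCl p) (hx : x ≠ 0) :
    ∃ n : ℕ, 0 < n ∧ ∃ m : ℤ, ‖x‖ ^ n = (p : ℝ) ^ m := by
  have hint : IsIntegral ℚ_[p] x := (Algebra.IsAlgebraic.isAlgebraic x).isIntegral
  have hn0 : 0 < (minpoly ℚ_[p] x).natDegree := minpoly.natDegree_pos hint
  have ha0 : (minpoly ℚ_[p] x).coeff 0 ≠ 0 := minpoly.coeff_zero_ne_zero hint hx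
  refine ⟨(minpoly ℚ_[p] x).natDegree, hn0, -((minpoly ℚ_[p] x).coeff 0).valuation, ?_⟩
  have h1 : ‖x‖ = ‖(minpoly ℚ_[p] x).coeff 0‖ ^ (1 / ((minpoly ℚ_[p] x).natDegree : ℝ)) := by
    rw [← PadicAlgCl.spectralNorm_eq]
    exact spectralNorm.spectralNorm_eq_norm_coeff_zero_rpow ℚ_[p] (PadicAlgCl p) x
  rw [h1, one_div, Real.rpow_inv_natCast_pow (norm_nonneg _) hn0.ne', Padic.norm_eq_zpow_neg_valuation ha0]

/-- Ultrametric equality: a point closer to `y` than `‖y‖` has norm `‖y‖`. [folklore] -/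
theorem norm_eq_of_norm_sub_lt' {E : Type*} [NormedAddCommGroup E] [IsUltrametricDist E] {x y : E}
    (h : ‖x - y‖ < ‖y‖) : ‖x‖ = ‖y‖ := by
  apply le_antisymm
  · have := IsUltrametricDist.norm_add_le_max (x - y) y
    rw [sub_add_cancel] at this
    exact this.trans (max_le h.le le_rfl)
  · by_contra hlt
    rw [not_le] at hlt
    rw [norm_sub_rev] at h
    have : ‖y‖ < ‖y‖ :=
      calc ‖y‖ = ‖(y - x) + x‖ := by rw [sub_add_cancel]
        _ ≤ max ‖y - x‖ ‖x‖ := IsUltrametricDist.norm_add_le_max _ _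
        _ < ‖y‖ := max_lt h hlt
    exact lt_irrefl _ this

/-- **THE VALUE SET OF `ℂ_p`**: every nonzero `y ∈ ℂ_p` has `‖y‖ⁿ = p^m` for some `n ≥ 1`, `m ∈ ℤ` (so `|ℂ_p^×| = p^ℚ`,
cf. [J-I] Prop. 4.1.7 (1) «the same value groups as that of `F`»). [folklore] -/
theorem exists_norm_pow_eq_padicComplex (y : ℂ_[p]) (hy : y ≠ 0) :
    ∃ n : ℕ, 0 < n ∧ ∃ m : ℤ, ‖y‖ ^ n = (p : ℝ) ^ m := by
  have hpos : 0 < ‖y‖ := norm_pos_iff.mpr hy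
  obtain ⟨x, hx⟩ := (UniformSpace.Completion.denseRange_coe (α := PadicAlgCl p)).exists_dist_lt y hpos
  rw [dist_eq_norm, ← norm_neg, neg_sub] at hx
  have hxy : ‖(x : ℂ_[p])‖ = ‖y‖ := norm_eq_of_norm_sub_lt' hx
  have hx0 : x ≠ 0 := by
    rintro rfl
    rw [UniformSpace.Completion.coe_zero, norm_zero] at hxy
    exact hpos.ne' hxy.symm
  obtain ⟨n, hn, m, hm⟩ := exists_norm_pow_eq_padicAlgCl p x hx0
  exact ⟨n, hn, m, by rw [← hxy, PadicComplex.norm_extends, hm]⟩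

/-! ## 2. Separation from `ℂ_p` -/

/-- `‖p‖ = p⁻¹` in E-t1's untilt `ℂ_p`. [folklore] -/
theorem norm_p_padicComplex : ‖(p : (Untilt.padicComplex p).K)‖ = (p : ℝ)⁻¹ := by
  show ‖(p : ℂ_[p])‖ = _
  rw [← map_natCast (algebraMap (PadicAlgCl p) ℂ_[p]) p]
  show ‖((p : PadicAlgCl p) : ℂ_[p])‖ = _
  rw [PadicComplex.norm_extends, ← map_natCast (algebraMap ℚ_[p] (PadicAlgCl p)) p, PadicAlgCl.norm_extends,
    Padic.norm_p]

/-- **Generic separation**: an untilt with the standard normalisation `‖p‖ = p⁻¹` that holds an element of norm `r`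
with `rⁿ ≠ p^m` for all `n ≥ 1`, `m ∈ ℤ`, is NOT topologically isomorphic to `ℂ_p` — a topological isomorphism would be
an ISOMETRY (my p438930 `Untilt.TopEquiv.norm_eq_of_norm_p_eq`), contradicting §1. [folklore] -/
theorem not_topIso_padicComplex_of_norm (V : Untilt p) (hp : ‖(p : V.K)‖ = (p : ℝ)⁻¹) (t : V.K) {r : ℝ}
    (ht : ‖t‖ = r) (hr0 : r ≠ 0) (hr : ∀ n : ℕ, 0 < n → ∀ m : ℤ, r ^ n ≠ (p : ℝ) ^ m) :
    ¬ (Untilt.padicComplex p).TopIso V := by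
  rintro ⟨e⟩
  have hpp : ‖(p : (Untilt.padicComplex p).K)‖ = ‖(p : V.K)‖ := by rw [norm_p_padicComplex, hp]
  have hiso := Untilt.TopEquiv.norm_eq_of_norm_p_eq e hpp
  set y : (Untilt.padicComplex p).K := e.toRingEquiv.symm t with hy
  have hty : ‖t‖ = ‖y‖ := by rw [← hiso y, hy, RingEquiv.apply_symm_apply]
  have hy0 : y ≠ 0 := by
    intro h0
    rw [h0, norm_zero] at hty
    exact hr0 (ht.symm.trans hty)
  obtain ⟨n, hn, m, hm⟩ := exists_norm_pow_eq_padicComplex p y hy0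
  exact hr n hn m (by rw [← ht, hty]; exact hm)

/-- The radius `p^√2` avoids the value set of `ℂ_p`: `(p^√2)ⁿ ≠ p^m` (`√2 ∉ ℚ`). [folklore] -/
theorem rpow_sqrt_two_pow_ne (n : ℕ) (hn : 0 < n) (m : ℤ) : ((p : ℝ) ^ Real.sqrt 2) ^ n ≠ (p : ℝ) ^ m := by
  have hp1 : 1 < (p : ℝ) := by exact_mod_cast (Fact.out : p.Prime).one_lt
  intro h
  rw [← Real.rpow_natCast, ← Real.rpow_mul (by positivity), ← Real.rpow_intCast] at h
  have hinj : Real.sqrt 2 * n = (m : ℝ) := by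
    by_contra hne
    rcases lt_or_gt_of_ne hne with hlt | hlt
    · exact (Real.rpow_lt_rpow_of_exponent_lt hp1 hlt).ne h
    · exact (Real.rpow_lt_rpow_of_exponent_lt hp1 hlt).ne h.symm
  exact (irrational_sqrt_two.mul_natCast hn.ne').ne_int m hinj

/-- `0 < p^√2`. [folklore] -/
theorem rpow_sqrt_two_pos : 0 < (p : ℝ) ^ Real.sqrt 2 :=
  Real.rpow_pos_of_pos (by exact_mod_cast (Fact.out : p.Prime).pos) _

end GaussUntilt

/-- **`𝔾 := Untilt.gaussIrr p`** — the Gauss untilt of radius `p^√2`. [folklore] -/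
def Untilt.gaussIrr : Untilt p := Untilt.gauss p ((p : ℝ) ^ Real.sqrt 2) (GaussUntilt.rpow_sqrt_two_pos p)

/-- **`ℂ_p` and `𝔾` are NOT topologically isomorphic** — E-t1's `Untilt.TopIso` FAILS between two kernel untilts
(AS TYPED: `𝔾` is not an untilt of `ℂ_p^♭`; module docstring). [folklore] -/
theorem Untilt.not_topIso_padicComplex_gaussIrr : ¬ (Untilt.padicComplex p).TopIso (Untilt.gaussIrr p) :=
  GaussUntilt.not_topIso_padicComplex_of_norm p (Untilt.gaussIrr p) (Untilt.norm_p_gauss p _ _)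
    (GaussUntilt.gaussT p _ _) (GaussUntilt.norm_gaussT p _ _) (GaussUntilt.rpow_sqrt_two_pos p).ne'
    (GaussUntilt.rpow_sqrt_two_pow_ne p)

/-- … and symmetrically. [folklore] -/
theorem Untilt.not_topIso_gaussIrr_padicComplex : ¬ (Untilt.gaussIrr p).TopIso (Untilt.padicComplex p) :=
  fun h => Untilt.not_topIso_padicComplex_gaussIrr p h.symm

/-- Two objects of `𝔍(X,E)` with non-homeomorphic perfectoid fields: `(X, E ↪ ℂ_p, id)` and `(X, E ↪ 𝔾, id)` (E-t1's
`ATSObj.self`; the second embedding is `E ⊆ Q̄_p ↪ 𝔾` through `GaussUntilt.algClGauss`, continuous on `ℚ_p`). [folklore] -/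
theorem ATSObj.exists_not_topIso (X : TemperedCurve p) : ∃ A B : ATSObj X, ¬ A.U.TopIso B.U :=
  ⟨ATSObj.self X (Untilt.padicComplex p) (ATSObj.embPadicComplex X) (ATSObj.continuous_embPadicComplex X),
   ATSObj.self X (Untilt.gaussIrr p) ((GaussUntilt.algClGauss p _ _).comp X.K.val.toRingHom)
     (by
       have := GaussUntilt.continuous_algClGauss_padic p ((p : ℝ) ^ Real.sqrt 2) (GaussUntilt.rpow_sqrt_two_pos p)
       refine this.congr fun x => ?_
       show GaussUntilt.algClGauss p _ _ (algebraMap ℚ_[p] (AlgebraicClosure ℚ_[p]) x) =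
         GaussUntilt.algClGauss p _ _ (X.K.val (algebraMap ℚ_[p] X.K x))
       rw [AlgHom.commutes]),
   Untilt.not_topIso_padicComplex_gaussIrr p⟩

/-- **[J-I] Thm. 7.4.3 (1) AS TYPED, HYPOTHESIS-FREE, for every `X`** (v4 p.42 l.21–27 «Non-isomorphic arithmetic
holomorphic structures on `X/E` exist»): E-t17's claim-`Prop` `ATS1.Thm743NonIso X` (`∃ A B : ATSObj X, ¬ A.IsIso B`),
there PROVED modulo `∃ A B, ¬ A.U.TopIso B.U`, now discharged by `ℂ_p` vs `𝔾`. CAVEAT: the two typed objects have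
perfectoid fields of DIFFERENT tilts — permitted by E-t1's `ATSObj` (no tilt datum), not Joshi's same-`F` mechanism
(Prop. 4.1.7 (2)). [claim: Joshi2021ATS1, status: disputed] -/
theorem ATS1.thm743NonIso_holds (X : TemperedCurve p) : ATS1.Thm743NonIso X :=
  ATS1.thm743NonIso_of_not_topIso X (ATSObj.exists_not_topIso p X)

/-- **`𝔍(X,E)` is a NON-TRIVIAL anabelian variation, hypothesis-free** (E-t1's `ATSObj.variation`; formerly
conditional on `ExistsNonIsomorphic`, `ATSObjF.not_isTrivial_of_existsNonIsomorphic`). [claim: Joshi2021ATS1, status: disputed] -/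
theorem ATSObj.variation_not_isTrivial (X : TemperedCurve p) : ¬ (ATSObj.variation X).IsTrivial :=
  ATSObj.not_isTrivial_of_exists_not_topIso X (ATSObj.exists_not_topIso p X)

namespace GaussUntilt

/-! ## 3. A two-point signature: `ExistsNonIsomorphic`, `ActionChangesTopology`, and NO dilatation -/

/-- The two residue fields: `ℂ_p` (at `true`) and `𝔾` (at `false`). [folklore] -/
def twoUntilt : Bool → Untilt p
  | true => Untilt.padicComplex p
  | false => Untilt.gaussIrr p

/-- Their preferred algebraic closures `Q̄_p ↪ K_y`. [folklore] -/
def twoAlgCl : (b : Bool) → (AlgebraicClosure ℚ_[p] →+* (twoUntilt p b).K)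
  | true => UniformSpace.Completion.coeRingHom (α := PadicAlgCl p)
  | false => algClGauss p ((p : ℝ) ^ Real.sqrt 2) (rpow_sqrt_two_pos p)

/-- Both preferred algebraic closures are ISOMETRIC for the `p`-adic norm of `Q̄_p`. [folklore] -/
theorem norm_twoAlgCl : ∀ (b : Bool) (x : AlgebraicClosure ℚ_[p]), ‖twoAlgCl p b x‖ = ‖x‖
  | true, x => PadicComplex.norm_extends p x
  | false, x => norm_algClGauss p _ _ x

/-- Both are continuous on `ℚ_p`. [folklore] -/
theorem continuous_twoAlgCl : ∀ b : Bool,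
    Continuous fun x : ℚ_[p] => twoAlgCl p b (algebraMap ℚ_[p] (AlgebraicClosure ℚ_[p]) x)
  | true => (UniformSpace.Completion.continuous_coe _).comp (continuous_algebraMap ℚ_[p] (PadicAlgCl p))
  | false => continuous_algClGauss_padic p _ _

open Classical in
/-- Selector on `(𝔽₂² − {0})/𝔽₂^× = {e₁, e₂, e₁+e₂}`: `true` at E-t17's `e1`, `false` elsewhere. [folklore] -/
def sel (y : ProjPoints (ZMod 2) (ZMod 2 × ZMod 2)) : Bool := if y = e1 then true else false

/-- `sel e₁ = true`. [folklore] -/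
theorem sel_e1 : sel e1 = true := by simp [sel]

/-- `sel e₂ = false`. [folklore] -/
theorem sel_e2 : sel e2 = false := by simp [sel, e1_ne_e2.symm]

/-- **THE TWO-POINT SIGNATURE** `twoPoint p : UntiltPoints p 𝔽₂`: `𝒢 := 𝔽₂²` (discrete), `|𝒴| := (𝒢 − {0})/𝔽₂^×`,
residue field `ℂ_p` at `e₁` and `𝔾` at the two other points, Frobenius the identity, preferred algebraic closures as
above. A MODEL of E-t1's signature (no claim of Joshi's used or asserted; the signature records no tilt). [folklore] -/
def twoPoint : UntiltPoints p (ZMod 2) where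
  Pt := ProjPoints (ZMod 2) (ZMod 2 × ZMod 2)
  untilt y := twoUntilt p (sel y)
  frob := Equiv.refl _
  algCl y := twoAlgCl p (sel y)
  continuous_algCl y := continuous_twoAlgCl p (sel y)
  G := ZMod 2 × ZMod 2
  topologicalSpace := ⊥
  ptEquiv := Equiv.refl _

/-- Unfolding `untilt`. [folklore] -/
theorem twoPoint_untilt (y : (twoPoint p).Pt) : (twoPoint p).untilt y = twoUntilt p (sel y) := rfl

/-- The residue field at `e₁` is `ℂ_p`. [folklore] -/
theorem twoPoint_untilt_e1 : (twoPoint p).untilt e1 = Untilt.padicComplex p := by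
  rw [twoPoint_untilt, sel_e1]; rfl

/-- The residue field at `e₂` is `𝔾`. [folklore] -/
theorem twoPoint_untilt_e2 : (twoPoint p).untilt e2 = Untilt.gaussIrr p := by
  rw [twoPoint_untilt, sel_e2]; rfl

/-- The swap `(a, b) ↦ (b, a)` of `𝔽₂²`, an element of `Aut_{𝒪_E}(𝒢)` of the model. [folklore] -/
def swap2 : (twoPoint p).Aut :=
  { LinearEquiv.prodComm (ZMod 2) (ZMod 2) (ZMod 2) with
    continuous_toFun := continuous_bot
    continuous_invFun := continuous_bot }

/-- The swap moves `e₁` to `e₂`. [folklore] -/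
theorem ptAct_swap2_e1 : (twoPoint p).ptAct (swap2 p) e1 = e2 := rfl

/-- **`ExistsNonIsomorphic` HOLDS on the two-point signature** — the first kernel inhabitant of E-t1's named `Prop`
(there a citation of [KedlayaTemkin2018, Thm 1.3] for `F = ℂ_p^♭`; HERE realised by untilts of different tilts, which
the typed signature permits — a calibration of the typing, not the cited theorem). [folklore] -/
theorem twoPoint_existsNonIsomorphic : (twoPoint p).ExistsNonIsomorphic :=
  ⟨e1, e2, by rw [twoPoint_untilt_e1, twoPoint_untilt_e2]; exact Untilt.not_topIso_padicComplex_gaussIrr p⟩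

/-- **`ActionChangesTopology` HOLDS on the two-point signature**: the swap carries `e₁` (residue field `ℂ_p`) to `e₂`
(residue field `𝔾`), not topologically isomorphic. First kernel inhabitant of E-t1's claim-`Prop` (AS TYPED). [folklore] -/
theorem twoPoint_actionChangesTopology : (twoPoint p).ActionChangesTopology :=
  ⟨swap2 p, e1, by
    rw [ptAct_swap2_e1, twoPoint_untilt_e1, twoPoint_untilt_e2]; exact Untilt.not_topIso_gaussIrr_padicComplex p⟩

/-- On `Q̄_p` every residue field of the model induces the `p`-adic norm. [folklore] -/
theorem norm_algCl_twoPoint (y : (twoPoint p).Pt) (x : AlgebraicClosure ℚ_[p]) : ‖(twoPoint p).algCl y x‖ = ‖x‖ :=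
  norm_twoAlgCl p (sel y) x

/-- **No dilatation**: `IsDilatation y y′ 1` for all points (E-t1's reading predicate of ATS I §10). [folklore] -/
theorem twoPoint_isDilatation_one (y y' : (twoPoint p).Pt) : (twoPoint p).IsDilatation y y' 1 := fun x => by
  rw [Real.rpow_one, norm_algCl_twoPoint, norm_algCl_twoPoint]

/-- The pulled-back absolute value on `ℚ_p` is `|·|_p` at every point. [folklore] -/
theorem twoPoint_normQp (y : (twoPoint p).Pt) (a : ℚ_[p]) : (twoPoint p).normQp y a = ‖a‖ := by
  unfold UntiltPoints.normQp
  rw [norm_algCl_twoPoint]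
  exact PadicAlgCl.norm_extends p a

/-- **The exponent (p431060) is `1` at every point**: both holomorphic structures carry the STANDARD normalisation. [folklore] -/
theorem twoPoint_exponent (y : (twoPoint p).Pt) : (twoPoint p).exponent y = 1 := by
  have hp1 : 1 < (p : ℝ) := by exact_mod_cast (Fact.out : p.Prime).one_lt
  have h0 : 0 < ((p : ℝ))⁻¹ := inv_pos.2 (by linarith)
  have h1 : ((p : ℝ))⁻¹ ≠ 1 := (inv_lt_one_of_one_lt₀ hp1).ne
  unfold UntiltPoints.exponent
  rw [twoPoint_normQp, Padic.norm_p, div_self (Real.log_ne_zero_of_pos_of_ne_one h0 h1)]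

/-- **`ActionDilates` FAILS on the two-point signature** although `ActionChangesTopology` holds: a change of arithmetic
holomorphic structure INVISIBLE to every valuation/exponent read-out on `Q̄_p` (cf. E-t1's `DictionaryUntiltsReadout`,
E-t17's `threePoint_actionDilates` where the opposite configuration — dilatation WITH topological isomorphism — is
realised). Located, not adjudicated. [folklore] -/
theorem twoPoint_not_actionDilates : ¬ (twoPoint p).ActionDilates := by
  rw [UntiltPoints.actionDilates_iff_exponent_ne]
  rintro ⟨σ, y, hne⟩
  exact hne (by rw [twoPoint_exponent, twoPoint_exponent])

/-- The conjunction, for citation: topology changes, valuations on `Q̄_p` do not. [folklore] -/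
theorem twoPoint_changesTopology_not_dilates :
    (twoPoint p).ActionChangesTopology ∧ ¬ (twoPoint p).ActionDilates :=
  ⟨twoPoint_actionChangesTopology p, twoPoint_not_actionDilates p⟩

end GaussUntilt

end Summit.ABC.IUTFork.Joshi


/-! ## NOTE (erratum to the module docstring, append-only; abc-iut-E-t55 g3)

ATTRIBUTION CORRECTION. Line 16 of the header reads «E-t17's `e1`/`e2` (p43xxxx `UntiltRescaled`)»; the placeholder and the
seat are wrong: `e1`, `e2`, `e1_ne_e2`, `Untilt.rescaled`, `threePoint`, `threePoint_actionDilates`, `threePoint_topIso` are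
abc-iut-**E-t1**'s `Joshi/UntiltRescaled.lean`, **p432361**; likewise every «E-t17's `threePoint…`» / «E-t16/E-t17's
`Untilt.rescaled`» in this file's and `Joshi/UntiltGauss.lean`'s docstrings should read «E-t1's … (p432361)». The claim-`Prop`
`ATS1.Thm743NonIso` / `thm743NonIso_of_not_topIso` ARE abc-iut-E-t17's (`Joshi/ATS1UntiltsOfFundamentalGroups.lean`, p430648), as
stated. No declaration is touched by this note. -/

end
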